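import Mathlib.Analysis.InnerProductSpace.GramSchmidtOrtho
import Mathlib.Analysis.InnerProductSpace.Projection.Basic
import Mathlib.Analysis.InnerProductSpace.Projection.FiniteDimensional
import Mathlib.LinearAlgebra.Matrix.Determinant.Basic
import Mathlib.LinearAlgebra.Matrix.NonsingularInverse
import HarnessLib

/-!
# The Gram–Hadamard inequality `|det ⟪f_i, g_j⟫| ≤ ∏ ‖f_i‖ ‖g_j‖`

`Literature/Analysis/InnerProduct/`. The determinant bound that makes fermionic perturbation
theory converge (Mastropietro, *Non-Perturbative Renormalization* (2008), Lemma 2.2, eq. (2.66):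
"the Gram inequality"; Benfatto–Giuliani–Mastropietro, Ann. Henri Poincaré 7 (2006) 809, before
(2.80): "a standard application of Gram–Hadamard inequality" — node T2 of the programme under the
tree's fact `bgm_two_point_limit`). PROVED here, for an inner product space `E` of any dimension
over `𝕜 = ℝ, ℂ`:

* `norm_det_le_prod_norm` — Hadamard's inequality `|det_e(f₁,…,fₙ)| ≤ ∏ ‖f_k‖` for the
  determinant in an orthonormal basis `e` of an `n`-dimensional space (Gram–Schmidt; the tree's
  `Literature.Analysis.Toeplitz.norm_det_le_prod_norm_col` is the `ℂⁿ`-column special case);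
* `inner_matrix_eq_conjTranspose_mul` — `[⟪f_i, g_j⟫] = Fᴴ G` for the coordinate matrices;
  `norm_det_inner_le_of_orthonormalBasis` — the square case of Gram–Hadamard;
* `det_inner_eq_zero_of_not_linearIndependent` — dependent `g_j` give determinant `0`;
* `norm_det_inner_le_prod_norm_mul_prod_norm` — **Gram–Hadamard**: for `f, g : Fin n → E`,
  `‖det [⟪f_i, g_j⟫]‖ ≤ (∏ ‖f_i‖)(∏ ‖g_j‖)` (Mastropietro's proof: reduce to the span of the `g_j`
  by the orthogonal projection, then the square case).

## Mathlib / tree search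

Mathlib: `Matrix.gram`, `Matrix.posSemidef_gram`, `det_gram_ne_zero_iff_linearIndependent`
(`Analysis/InnerProductSpace/GramMatrix`), `gramSchmidtOrthonormalBasis_det`,
`OrthonormalBasis.det_to_matrix_orthonormalBasis`, `LinearMap.normDet` (`NormDet`), but no
Hadamard or Gram–Hadamard determinant INEQUALITY (`lean search 'Hadamard.*det|det_gram_le'`).
Tree: the Toeplitz special case above.

## References

* V. Mastropietro, *Non-Perturbative Renormalization* (World Scientific 2008), §2, Lemma 2.2,
  eq. (2.66). [Mastropietro2008]
* G. Benfatto, A. Giuliani, V. Mastropietro, Ann. Henri Poincaré 7 (2006) 809–898, §2.8, before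
  eq. (2.80). [BenfattoGiulianiMastropietro2006]
-/

noncomputable section

open Finset Submodule Module InnerProductSpace Matrix
open scoped InnerProductSpace

namespace Literature.Analysis.InnerProduct

variable {𝕜 : Type*} [RCLike 𝕜] {E : Type*} [NormedAddCommGroup E] [InnerProductSpace 𝕜 E]

/-! ### Hadamard's inequality for the determinant in an orthonormal basis -/

/-- **Hadamard's inequality**: in an `n`-dimensional inner product space, the determinant of `n`
vectors in any orthonormal basis is bounded by the product of their norms,
`|det_e(f₁, …, fₙ)| ≤ ∏ ‖f_k‖` (Gram–Schmidt: the determinant in the Gram–Schmidt basis of `f` is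
the product of the diagonal inner products, and orthonormal changes of basis have determinant
of modulus one). [folklore] -/
theorem norm_det_le_prod_norm {n : ℕ} (e : OrthonormalBasis (Fin n) 𝕜 E) (f : Fin n → E) :
    ‖e.toBasis.det f‖ ≤ ∏ k, ‖f k‖ := by
  haveI : FiniteDimensional 𝕜 E := e.toBasis.finiteDimensional_of_finite
  have hdim : finrank 𝕜 E = Fintype.card (Fin n) := by
    rw [finrank_eq_card_basis e.toBasis]
  set b := gramSchmidtOrthonormalBasis hdim f with hb
  have hchange : e.toBasis.det f = e.toBasis.det b * b.toBasis.det f := by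
    have h := AlternatingMap.eq_smul_basis_det b.toBasis e.toBasis.det
    have h' := congrArg (fun g : E [⋀^Fin n]→ₗ[𝕜] 𝕜 => g f) h
    simp only [AlternatingMap.smul_apply, smul_eq_mul] at h'
    rw [h']
    rfl
  have hnorm1 : ‖e.toBasis.det b‖ = 1 := e.det_to_matrix_orthonormalBasis b
  rw [hchange, norm_mul, hnorm1, one_mul, gramSchmidtOrthonormalBasis_det hdim f, norm_prod]
  refine Finset.prod_le_prod (fun k _ => norm_nonneg _) fun k _ => ?_
  calc ‖⟪b k, f k⟫_𝕜‖ ≤ ‖b k‖ * ‖f k‖ := norm_inner_le_norm _ _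
    _ = ‖f k‖ := by rw [b.orthonormal.1 k, one_mul]

/-! ### The Gram–Hadamard inequality -/

/-- The matrix of inner products `[⟪f_i, g_j⟫]` is `Fᴴ G` for the coordinate matrices in an
orthonormal basis. [folklore] -/
theorem inner_matrix_eq_conjTranspose_mul {n : ℕ} (e : OrthonormalBasis (Fin n) 𝕜 E)
    (f g : Fin n → E) :
    (Matrix.of fun i j => ⟪f i, g j⟫_𝕜) = (e.toBasis.toMatrix f)ᴴ * e.toBasis.toMatrix g := by
  ext i j
  simp only [Matrix.of_apply, Matrix.mul_apply, Matrix.conjTranspose_apply, Basis.toMatrix_apply,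
    OrthonormalBasis.coe_toBasis_repr_apply, OrthonormalBasis.repr_apply_apply, RCLike.star_def,
    inner_conj_symm]
  exact (e.sum_inner_mul_inner (f i) (g j)).symm

/-- **Gram–Hadamard, square case**: for `n` + `n` vectors in an `n`-dimensional inner product
space, `|det [⟪f_i, g_j⟫]| ≤ (∏ ‖f_i‖)(∏ ‖g_j‖)`. [folklore] -/
theorem norm_det_inner_le_of_orthonormalBasis {n : ℕ} (e : OrthonormalBasis (Fin n) 𝕜 E)
    (f g : Fin n → E) :
    ‖(Matrix.of fun i j => ⟪f i, g j⟫_𝕜).det‖ ≤ (∏ i, ‖f i‖) * ∏ j, ‖g j‖ := by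
  rw [inner_matrix_eq_conjTranspose_mul e, det_mul, det_conjTranspose, norm_mul, norm_star,
    ← Basis.det_apply, ← Basis.det_apply]
  exact mul_le_mul (norm_det_le_prod_norm e f) (norm_det_le_prod_norm e g) (norm_nonneg _)
    (Finset.prod_nonneg fun _ _ => norm_nonneg _)

/-- If the `g_j` are linearly dependent, `det [⟪f_i, g_j⟫] = 0`. [folklore] -/
theorem det_inner_eq_zero_of_not_linearIndependent {n : ℕ} (f g : Fin n → E)
    (hg : ¬LinearIndependent 𝕜 g) : (Matrix.of fun i j => ⟪f i, g j⟫_𝕜).det = 0 := by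
  obtain ⟨c, hc, i₀, hi₀⟩ := Fintype.not_linearIndependent_iff.1 hg
  refine Matrix.exists_mulVec_eq_zero_iff.1 ⟨c, fun h => hi₀ (by rw [h]; rfl), ?_⟩
  funext i
  simp only [Matrix.mulVec, dotProduct, Matrix.of_apply, Pi.zero_apply]
  calc ∑ j, ⟪f i, g j⟫_𝕜 * c j = ⟪f i, ∑ j, c j • g j⟫_𝕜 := by
        rw [inner_sum]
        exact Finset.sum_congr rfl fun j _ => by rw [inner_smul_right, mul_comm]
    _ = 0 := by rw [hc, inner_zero_right]

/-- **The Gram–Hadamard inequality.** For vectors `f₁, …, fₙ`, `g₁, …, gₙ` of an inner product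
space (of any dimension), `|det [⟪f_i, g_j⟫]_{i,j}| ≤ ∏_i ‖f_i‖ · ∏_j ‖g_j‖`. Proof: if the `g_j`
are dependent the determinant vanishes; otherwise work in the `n`-dimensional span `V` of the
`g_j`, replacing `f_i` by its orthogonal projection onto `V` (which does not change the inner
products and does not increase norms), and apply the square case (Hadamard's inequality for the
two coordinate matrices). This is the determinant bound behind the convergence of fermionic
perturbation theory (Benfatto–Giuliani–Mastropietro 2006, before (2.80): "a standard application
of Gram–Hadamard inequality"). Mastropietro, *Non-Perturbative Renormalization* (2008), Lemma 2.2,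
eq. (2.66). [cite: Mastropietro2008, Lemma 2.2 eq. (2.66)] -/
theorem norm_det_inner_le_prod_norm_mul_prod_norm {n : ℕ} (f g : Fin n → E) :
    ‖(Matrix.of fun i j => ⟪f i, g j⟫_𝕜).det‖ ≤ (∏ i, ‖f i‖) * ∏ j, ‖g j‖ := by
  by_cases hg : LinearIndependent 𝕜 g
  · -- the span of the `g_j` and the orthogonal projection onto it
    set V : Submodule 𝕜 E := span 𝕜 (Set.range g) with hV
    haveI : FiniteDimensional 𝕜 V := FiniteDimensional.span_of_finite 𝕜 (Set.finite_range g)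
    have hdimV : finrank 𝕜 V = n := by
      rw [hV, finrank_span_eq_card hg, Fintype.card_fin]
    let e : OrthonormalBasis (Fin n) 𝕜 V := (stdOrthonormalBasis 𝕜 V).reindex (finCongr hdimV)
    let g' : Fin n → V := fun j => ⟨g j, subset_span (Set.mem_range_self j)⟩
    let f' : Fin n → V := fun i => V.orthogonalProjectionOnto (f i)
    have hinner : ∀ i j, ⟪f i, g j⟫_𝕜 = @inner 𝕜 V _ (f' i) (g' j) := fun i j =>
      (Submodule.inner_orthogonalProjectionOnto_eq_of_mem_right (g' j) (f i)).symm
    have hM : (Matrix.of fun i j => ⟪f i, g j⟫_𝕜) =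
        Matrix.of fun i j => @inner 𝕜 V _ (f' i) (g' j) := by
      ext i j; exact hinner i j
    rw [hM]
    refine (norm_det_inner_le_of_orthonormalBasis e f' g').trans ?_
    refine mul_le_mul (Finset.prod_le_prod (fun _ _ => norm_nonneg _) fun i _ => ?_)
      (le_of_eq (Finset.prod_congr rfl fun j _ => Submodule.coe_norm _))
      (Finset.prod_nonneg fun _ _ => norm_nonneg _) (Finset.prod_nonneg fun _ _ => norm_nonneg _)
    calc ‖f' i‖ ≤ ‖V.orthogonalProjectionOnto‖ * ‖f i‖ := V.orthogonalProjectionOnto.le_opNorm (f i)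
      _ ≤ 1 * ‖f i‖ := by gcongr; exact Submodule.orthogonalProjectionOnto_norm_le V
      _ = ‖f i‖ := one_mul _
  · rw [det_inner_eq_zero_of_not_linearIndependent f g hg, norm_zero]
    exact mul_nonneg (Finset.prod_nonneg fun _ _ => norm_nonneg _)
      (Finset.prod_nonneg fun _ _ => norm_nonneg _)

end Literature.Analysis.InnerProduct
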